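import Summits.QuantumFields.YangMills.Theses.ConvexGribovBody
import Summits.QuantumFields.YangMills.Theorems.ConvexGribovBodyCovarianceBoundDefs
import Summits.QuantumFields.YangMills.Theorems.FradkinShenkerFlowPoincareToClusteringHeatBath
import Literature.RepresentationTheory.CompactGroups.MatrixGroupExpSurjective

/-!
# Crux `BrascampLiebVacuumSC` (stmt-QuantumFields-16404), line `SketchIdeator1`: helpers for `stub_onelinkHS`, I

Toolkit for the annealed one-link metric-slope Poincaré inequality (`stub_onelinkHS`): the Frobenius
geometry of `G` pulled back by a faithful unitary lattice representation `r` (`‖ρ(gh) − ρ(gk)‖_F =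
‖ρ h − ρ k‖_F`, faithfulness, Lipschitz ⇒ continuous and bounded), the difference quotients
`|φ h − φ x| / ‖ρ h − ρ x‖_F` and the metric slope `limsup_{h → x, h ≠ x}` of their `ENNReal.ofReal`
(bounded by the Lipschitz constant; conversion to and from the real `limsup`), and the **word
decomposition** `exists_word`: by von Neumann's closed-subgroup theorem for the compact image
`r.ρ(G) ⊆ U(N)` (tree `MatrixLie.exists_nhds_subset_exp_image_of_mem_nhds`) together with connectedness
and compactness, every `k ∈ G` is a product of boundedly many `k_i` with `r.ρ k_i = exp X_i`,
`‖X_i‖_F ≤ 1`, `exp(ℝ X_i) ⊆ r.ρ(G)`.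

References: J. von Neumann, Math. Z. 30 (1929) 3–42; T. Bröcker, T. tom Dieck, *Representations of
Compact Lie Groups* (1985), I (3.11); R. Holley, D. Stroock, J. Stat. Phys. 46 (1987) 1159–1194;
F. Martinelli, *Lectures on Glauber dynamics for discrete spin models*, LNM 1717 (1999), §2.3.
-/

open scoped BigOperators Topology Matrix ENNReal
open Filter MeasureTheory ProbabilityTheory
open Literature.MathematicalPhysics.QuantumFieldTheory
open Literature.RepresentationTheory.CompactGroups
open Summit.QuantumFields.YangMills.Cruxes.CovarianceBound.SupportWindow
  (froSq coulombF IsCoulMin gluon modeCov supCov wilson4)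
open Summit.QuantumFields.YangMills.Theorems.PoincareClustering (hbLaw hbOp)

noncomputable section

namespace Summit.QuantumFields.YangMills.Theorems.BrascampLiebVacuumSC

/-! ### Matrix toolkit: the Frobenius norm written through `froSq` -/

section MatrixToolkit

variable {N : ℕ}

/-- `√(froSq A) = ‖A‖_F`. [folklore] -/
theorem onelink_sqrt_froSq (A : Matrix (Fin N) (Fin N) ℂ) : Real.sqrt (froSq A) = frobNorm A := rfl

/-- `‖t • A‖_F = |t| ‖A‖_F` for a real scalar. [folklore] -/
theorem onelink_frobNorm_real_smul (t : ℝ) (A : Matrix (Fin N) (Fin N) ℂ) :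
    frobNorm (t • A) = |t| * frobNorm A := by
  have h : (t • A) = ((t : ℂ) • A) := by
    ext i j
    simp only [Matrix.smul_apply, Complex.real_smul, smul_eq_mul]
  rw [h, frobNorm_smul, Complex.norm_real, Real.norm_eq_abs]

/-- The Frobenius norm is continuous. [folklore] -/
theorem onelink_continuous_frobNorm : Continuous (frobNorm : Matrix (Fin N) (Fin N) ℂ → ℝ) := by
  unfold frobNorm
  refine (continuous_finsetSum _ fun i _ => continuous_finsetSum _ fun j _ => ?_).sqrt
  exact ((continuous_id.matrix_elem i j).norm).pow 2

end MatrixToolkit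

/-! ### The Frobenius geometry of `G` pulled back by a lattice representation -/

section RepGeometry

variable {G : Type} [Group G] [TopologicalSpace G] (r : LatticeRep G)

/-- `ρ(g⁻¹) = ρ(g)ᴴ` for a unitary representation. [folklore] -/
theorem onelink_rho_inv (g : G) : r.ρ g⁻¹ = (r.ρ g)ᴴ := by
  have h1 : r.ρ g⁻¹ * r.ρ g = 1 := by rw [← map_mul, inv_mul_cancel, map_one]
  have h2 : r.ρ g * (r.ρ g)ᴴ = 1 := by
    have := Matrix.mem_unitaryGroup_iff.1 (r.mem_unitary g)
    rwa [Matrix.star_eq_conjTranspose] at this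
  calc r.ρ g⁻¹ = r.ρ g⁻¹ * (r.ρ g * (r.ρ g)ᴴ) := by rw [h2, Matrix.mul_one]
    _ = (r.ρ g)ᴴ := by rw [← Matrix.mul_assoc, h1, Matrix.one_mul]

/-- Left invariance of the pulled-back Frobenius distance: `‖ρ(gh) − ρ(gk)‖_F = ‖ρ h − ρ k‖_F`. [folklore] -/
theorem onelink_frobNorm_mul_left (g h k : G) :
    frobNorm (r.ρ (g * h) - r.ρ (g * k)) = frobNorm (r.ρ h - r.ρ k) := by
  rw [map_mul, map_mul, ← Matrix.mul_sub, frobNorm_unitary_mul (r.mem_unitary g)]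

/-- `‖ρ g − ρ h‖_F = 0 ↔ g = h` (faithfulness). [folklore] -/
theorem onelink_frobNorm_sub_eq_zero_iff (g h : G) : frobNorm (r.ρ g - r.ρ h) = 0 ↔ g = h := by
  constructor
  · intro h0
    -- every entry is bounded by the Frobenius norm, so `ρ g - ρ h = 0`
    refine r.injective (sub_eq_zero.1 ?_)
    ext i j
    have hle := norm_entry_le_frobNorm (r.ρ g - r.ρ h) i j
    rw [h0] at hle
    exact norm_le_zero_iff.1 hle
  · rintro rfl
    rw [sub_self, frobNorm_zero]

/-- `0 < ‖ρ g − ρ h‖_F` for `g ≠ h`. [folklore] -/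
theorem onelink_frobNorm_sub_pos {g h : G} (hne : g ≠ h) : 0 < frobNorm (r.ρ g - r.ρ h) :=
  lt_of_le_of_ne (frobNorm_nonneg _) fun h0 => hne ((onelink_frobNorm_sub_eq_zero_iff r g h).1
      h0.symm)

/-- `g ↦ ‖ρ g − ρ h‖_F` is continuous. [folklore] -/
theorem onelink_continuous_frobNorm_sub (h : G) : Continuous fun g => frobNorm (r.ρ g - r.ρ h) :=
  onelink_continuous_frobNorm.comp (r.continuous.sub continuous_const)

/-- A Frobenius-Lipschitz function on `G` is continuous. [folklore] -/
theorem onelink_continuous_of_lip {φ : G → ℝ} {K : ℝ}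
    (hφ : ∀ g h, |φ g - φ h| ≤ K * frobNorm (r.ρ g - r.ρ h)) : Continuous φ := by
  refine continuous_iff_continuousAt.2 fun h => ?_
  rw [ContinuousAt, tendsto_iff_norm_sub_tendsto_zero]
  refine squeeze_zero (fun g => norm_nonneg _) (fun g => (Real.norm_eq_abs _).le.trans (hφ g h)) ?_
  have hc := ((onelink_continuous_frobNorm_sub r h).const_mul K).tendsto h
  rwa [sub_self, frobNorm_zero, mul_zero] at hc

end RepGeometry

/-! ### The metric slope: difference quotients and their `limsup` -/

section Slope

variable {G : Type} [Group G] [TopologicalSpace G] (r : LatticeRep G)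

/-- The difference quotients are non-negative. [folklore] -/
theorem dq_nonneg (φ : G → ℝ) (x h : G) : 0 ≤ |φ h - φ x| / Real.sqrt (froSq (r.ρ h - r.ρ x)) :=
  div_nonneg (abs_nonneg _) (Real.sqrt_nonneg _)

/-- The difference quotients of a `K`-Lipschitz `φ` are `≤ K` (`K ≥ 0`). [folklore] -/
theorem dq_le {φ : G → ℝ} {K : ℝ} (hK : 0 ≤ K)
    (hφ : ∀ g h, |φ g - φ h| ≤ K * frobNorm (r.ρ g - r.ρ h)) (x h : G) :
    |φ h - φ x| / Real.sqrt (froSq (r.ρ h - r.ρ x)) ≤ K := by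
  rw [onelink_sqrt_froSq]
  by_cases hx : h = x
  · subst hx
    simp only [sub_self, abs_zero, zero_div]
    exact hK
  · rw [div_le_iff₀ (onelink_frobNorm_sub_pos r hx)]
    exact hφ h x

/-- The metric slope of a `K`-Lipschitz `φ` is `≤ K`. [folklore] -/
theorem eslope_le {φ : G → ℝ} {K : ℝ} (hK : 0 ≤ K)
    (hφ : ∀ g h, |φ g - φ h| ≤ K * frobNorm (r.ρ g - r.ρ h)) (x : G) :
    (limsup (fun h => ENNReal.ofReal (|φ h - φ x| / Real.sqrt (froSq (r.ρ h - r.ρ x)))) (𝓝[≠] x))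
        ≤ ENNReal.ofReal K :=
  limsup_le_of_le (by isBoundedDefault)
    (Eventually.of_forall fun h => ENNReal.ofReal_le_ofReal (dq_le r hK hφ x h))

/-- The metric slope of a Lipschitz `φ` is finite. [folklore] -/
theorem eslope_lt_top {φ : G → ℝ} {K : ℝ} (hK : 0 ≤ K)
    (hφ : ∀ g h, |φ g - φ h| ≤ K * frobNorm (r.ρ g - r.ρ h)) (x : G) : (limsup (fun h =>
        ENNReal.ofReal (|φ h - φ x| / Real.sqrt (froSq (r.ρ h - r.ρ x)))) (𝓝[≠] x)) < ∞ :=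
  (eslope_le r hK hφ x).trans_lt ENNReal.ofReal_lt_top

/-- The real `limsup` of the difference quotients maps to the metric slope under `ENNReal.ofReal`.
[folklore] -/
theorem ofReal_limsup_dq {φ : G → ℝ} {K : ℝ} (hK : 0 ≤ K)
    (hφ : ∀ g h, |φ g - φ h| ≤ K * frobNorm (r.ρ g - r.ρ h)) (x : G) [(𝓝[≠] x).NeBot] :
    ENNReal.ofReal (limsup (fun h => |φ h - φ x| / Real.sqrt (froSq (r.ρ h - r.ρ x))) (𝓝[≠] x)) =
        (limsup (fun h => ENNReal.ofReal (|φ h - φ x| / Real.sqrt (froSq (r.ρ h - r.ρ x)))) (𝓝[≠]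
        x)) :=
  Monotone.map_limsup_of_continuousAt ENNReal.ofReal_mono _ ENNReal.continuous_ofReal.continuousAt
    (isBoundedUnder_of ⟨K, fun h => dq_le r hK hφ x h⟩)
    (isCoboundedUnder_le_of_le _ fun h => dq_nonneg r φ x h)

/-- The real `limsup` of the difference quotients is non-negative. [folklore] -/
theorem limsup_dq_nonneg {φ : G → ℝ} {K : ℝ} (hK : 0 ≤ K)
    (hφ : ∀ g h, |φ g - φ h| ≤ K * frobNorm (r.ρ g - r.ρ h)) (x : G) [(𝓝[≠] x).NeBot] :
    0 ≤ limsup (fun h => |φ h - φ x| / Real.sqrt (froSq (r.ρ h - r.ρ x))) (𝓝[≠] x) :=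
  le_limsup_of_frequently_le (Frequently.of_forall fun h => dq_nonneg r φ x h)
    (isBoundedUnder_of ⟨K, fun h => dq_le r hK hφ x h⟩)

/-- The real `limsup` of the difference quotients is the real part of the metric slope. [folklore] -/
theorem limsup_dq_eq_toReal {φ : G → ℝ} {K : ℝ} (hK : 0 ≤ K)
    (hφ : ∀ g h, |φ g - φ h| ≤ K * frobNorm (r.ρ g - r.ρ h)) (x : G) [(𝓝[≠] x).NeBot] :
    limsup (fun h => |φ h - φ x| / Real.sqrt (froSq (r.ρ h - r.ρ x))) (𝓝[≠] x) = ((limsup (fun h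
        => ENNReal.ofReal (|φ h - φ x| / Real.sqrt (froSq (r.ρ h - r.ρ x)))) (𝓝[≠] x))).toReal := by
  rw [← ofReal_limsup_dq r hK hφ x, ENNReal.toReal_ofReal (limsup_dq_nonneg r hK hφ x)]

/-- Along any sequence `x_n → x`, `x_n ≠ x` eventually, the `limsup` of the quotients is at most the
slope. [folklore] -/
theorem limsup_seq_le_eslope (φ : G → ℝ) (x : G) {u : ℕ → G}
    (hu : Tendsto u atTop (𝓝[≠] x)) :
    limsup (fun n => ENNReal.ofReal (|φ (u n) - φ x| / Real.sqrt (froSq (r.ρ (u n) - r.ρ x))))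
        atTop ≤
      (limsup (fun h => ENNReal.ofReal (|φ h - φ x| / Real.sqrt (froSq (r.ρ h - r.ρ x)))) (𝓝[≠]
          x)) := by
  have h : limsup (fun n => ENNReal.ofReal (|φ (u n) - φ x| / Real.sqrt (froSq (r.ρ (u n) - r.ρ
      x))))
      atTop = limsup (fun h => ENNReal.ofReal (|φ h - φ x| / Real.sqrt (froSq (r.ρ h - r.ρ x))))
        (map u atTop) :=
    limsup_comp (fun h => ENNReal.ofReal (|φ h - φ x| / Real.sqrt (froSq (r.ρ h - r.ρ x)))) u atTop
  rw [h]
  exact limsup_le_limsup_of_le hu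

end Slope

/-! ### Words: every element is a bounded product of small exponentials -/

section Words

open scoped Pointwise

variable {G : Type} [Group G]

/-- Partial products (words): the empty word is `1`. [folklore] -/
theorem pp_zero (ks : ℕ → G) : ((List.range 0).map ks).prod = 1 := by
  simp [List.range_zero]

/-- Partial products (words): appending one letter. [folklore] -/
theorem pp_succ (ks : ℕ → G) (i : ℕ) :
    ((List.range (i + 1)).map ks).prod = ((List.range i).map ks).prod * ks i :=
  List.prod_range_succ ks i

/-- The word of length `m` only reads the letters below `m`. [folklore] -/
theorem pp_congr {ks ks' : ℕ → G} {m : ℕ} (h : ∀ i, i < m → ks i = ks' i) :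
    ((List.range m).map ks).prod = ((List.range m).map ks').prod := by
  induction m with
  | zero => rw [pp_zero, pp_zero]
  | succ n ih =>
    rw [pp_succ, pp_succ, ih (fun i hi => h i (Nat.lt_succ_of_lt hi)), h n (Nat.lt_succ_self n)]

/-- Constant words are powers. [folklore] -/
theorem pp_const (k : G) (n : ℕ) : ((List.range n).map (fun _ => k)).prod = k ^ n := by
  induction n with
  | zero => rw [pp_zero, pow_zero]
  | succ n ih => rw [pp_succ, ih, pow_succ]

/-- Unwinding membership in a set power `W ^ n` into a word. [folklore] -/
theorem exists_pp_of_mem_pow (W : Set G) :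
    ∀ (n : ℕ) (k : G), k ∈ W ^ n → ∃ ks : ℕ → G, ((List.range n).map ks).prod = k ∧
      ∀ i, i < n → ks i ∈ W := by
  intro n
  induction n with
  | zero =>
    intro k hk
    rw [pow_zero, Set.mem_one] at hk
    exact ⟨fun _ => 1, by rw [pp_zero, hk], fun i hi => absurd hi (Nat.not_lt_zero i)⟩
  | succ n ih =>
    intro k hk
    rw [pow_succ, Set.mem_mul] at hk
    obtain ⟨a, ha, b, hb, rfl⟩ := hk
    obtain ⟨ks', hks', hW⟩ := ih a ha
    refine ⟨Function.update ks' n b, ?_, fun i hi => ?_⟩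
    · rw [pp_succ, Function.update_self, ← hks']
      congr 1
      exact pp_congr fun i hi => Function.update_of_ne (ne_of_lt hi) _ _
    · rcases Nat.lt_succ_iff_lt_or_eq.1 hi with h | h
      · rw [Function.update_of_ne (ne_of_lt h)]
        exact hW i h
      · subst h
        rw [Function.update_self]
        exact hb

variable [TopologicalSpace G] [IsTopologicalGroup G] [CompactSpace G]

/-- **A symmetric open neighbourhood of `1` in a compact connected group generates the group in
boundedly many steps**: `W ^ m = G` for some `m`. [folklore] -/
theorem exists_pow_eq_univ [ConnectedSpace G] {W : Set G} (hW : IsOpen W) (h1 : (1 : G) ∈ W)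
    (hsymm : ∀ w ∈ W, w⁻¹ ∈ W) : ∃ m : ℕ, W ^ m = Set.univ := by
  have hopen : ∀ n : ℕ, IsOpen (W ^ (n + 1)) := fun n => by
    rw [pow_succ]
    exact hW.mul_left
  set P : Set G := ⋃ n : ℕ, W ^ (n + 1) with hP
  have hPopen : IsOpen P := isOpen_iUnion hopen
  have hPclosed : IsClosed P := by
    rw [← isOpen_compl_iff, isOpen_iff_mem_nhds]
    intro x hx
    have hnhd : {y : G | x⁻¹ * y ∈ W} ∈ 𝓝 x :=
      (hW.preimage (continuous_const.mul continuous_id)).mem_nhds (by simp [h1])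
    refine Filter.mem_of_superset hnhd fun y hy hyP => hx ?_
    obtain ⟨n, hn⟩ := Set.mem_iUnion.1 hyP
    refine Set.mem_iUnion.2 ⟨n + 1, ?_⟩
    rw [pow_succ, Set.mem_mul]
    exact ⟨y, hn, (x⁻¹ * y)⁻¹, hsymm _ hy, by group⟩
  have hPuniv : P = Set.univ :=
    IsClopen.eq_univ ⟨hPclosed, hPopen⟩ ⟨1, Set.mem_iUnion.2 ⟨0, by rw [zero_add, pow_one]; exact
        h1⟩⟩
  obtain ⟨t, ht⟩ := isCompact_univ.elim_finite_subcover (fun n : ℕ => W ^ (n + 1)) hopen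
    (by rw [← hP, hPuniv])
  refine ⟨t.sup id + 1, Set.eq_univ_of_univ_subset (ht.trans (Set.iUnion₂_subset fun n hn => ?_))⟩
  exact Set.pow_subset_pow_right h1 (Nat.succ_le_succ (Finset.le_sup (f := id) hn))

variable (r : LatticeRep G)

omit [IsTopologicalGroup G] in
/-- The image `r.ρ(G) ⊆ U(N)` is a closed unitary matrix group. [folklore] -/
theorem onelink_isClosedUnitaryGroup : MatrixLie.IsClosedUnitaryGroup (Set.range r.ρ) where
  one_mem := ⟨1, map_one r.ρ⟩
  mul_mem := by
    rintro _ _ ⟨a, rfl⟩ ⟨b, rfl⟩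
    exact ⟨a * b, map_mul r.ρ a b⟩
  star_mem := by
    rintro _ ⟨a, rfl⟩
    exact ⟨a⁻¹, onelink_rho_inv r a⟩
  mem_unitary := by
    rintro _ ⟨a, rfl⟩
    exact r.mem_unitary a
  isClosed := (isCompact_range r.continuous).isClosed

open scoped Matrix.Norms.Operator in
/-- **Word decomposition** (von Neumann's closed-subgroup theorem + connectedness + compactness):
there is `m` such that every `k ∈ G` is a product `k = k_0 ⋯ k_{m-1}` with `r.ρ k_i = exp X_i`,
`‖X_i‖_F ≤ 1`, and `exp (t X_i) ∈ r.ρ(G)` for all real `t` (Bröcker–tom Dieck I (3.11) for the chart).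
[folklore] -/
theorem exists_word [ConnectedSpace G] :
    ∃ m : ℕ, ∀ k : G, ∃ ks : ℕ → G, ((List.range m).map ks).prod = k ∧ ∀ i, i < m →
      ∃ X : Matrix (Fin r.N) (Fin r.N) ℂ, (∀ t : ℝ, ∃ kt : G, r.ρ kt = NormedSpace.exp (t • X)) ∧
        frobNorm X ≤ 1 ∧ NormedSpace.exp X = r.ρ (ks i) := by
  have hS := onelink_isClosedUnitaryGroup r
  have hU : {X : Matrix (Fin r.N) (Fin r.N) ℂ | frobNorm X < 1} ∈ 𝓝 (0 : Matrix (Fin r.N) (Fin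
      r.N) ℂ) :=
    (isOpen_lt onelink_continuous_frobNorm continuous_const).mem_nhds (by
      simp only [Set.mem_setOf_eq, frobNorm_zero]; exact one_pos)
  obtain ⟨ε, hε, hchart⟩ := MatrixLie.exists_nhds_subset_exp_image_of_mem_nhds hS hU
  set V : Set G := {k | dist (r.ρ k) 1 < ε} with hV
  have hVopen : IsOpen V := by
    have : V = r.ρ ⁻¹' Metric.ball 1 ε := by ext k; simp [hV, Metric.mem_ball]
    rw [this]
    exact Metric.isOpen_ball.preimage r.continuous
  have h1V : (1 : G) ∈ V := by
    change dist (r.ρ 1) 1 < ε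
    rw [map_one, dist_self]; exact hε
  set W : Set G := V ∩ V⁻¹ with hW
  have hWopen : IsOpen W := hVopen.inter hVopen.inv
  have h1W : (1 : G) ∈ W := ⟨h1V, by change (1 : G)⁻¹ ∈ V; rw [inv_one]; exact h1V⟩
  have hWsymm : ∀ w ∈ W, w⁻¹ ∈ W := fun w hw => ⟨hw.2, by change w⁻¹⁻¹ ∈ V; rw [inv_inv]; exact
      hw.1⟩
  obtain ⟨m, hm⟩ := exists_pow_eq_univ hWopen h1W hWsymm
  refine ⟨m, fun k => ?_⟩
  obtain ⟨ks, hks, hksW⟩ := exists_pp_of_mem_pow W m k (by rw [hm]; exact Set.mem_univ k)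
  refine ⟨ks, hks, fun i hi => ?_⟩
  obtain ⟨X, hXL, hX1, hXexp⟩ := hchart (r.ρ (ks i)) ⟨ks i, rfl⟩ (hksW i hi).1
  refine ⟨X, fun t => ?_, le_of_lt hX1, hXexp⟩
  obtain ⟨kt, hkt⟩ := (MatrixLie.mem_lieAlg hS).1 hXL t
  exact ⟨kt, hkt⟩

/-- **Registered sub-goal of `stub_onelinkHS` (word decomposition, closed form of `exists_word`).** For a
compact connected `G` with a faithful unitary lattice representation `r` there is `m` such that every
`k ∈ G` is a product `k = k_0 ⋯ k_{m-1}` with `r.ρ k_i = exp X_i`, `‖X_i‖_F ≤ 1` and `exp(t X_i) ∈ r.ρ(G)`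
for all real `t` (von Neumann's closed-subgroup theorem for `r.ρ(G) ⊆ U(N)`, connectedness, compactness).
[folklore] -/
theorem stub_onelinkHS_words :
    ∀ (G : Type) [Group G] [TopologicalSpace G] [IsTopologicalGroup G] [CompactSpace G]
    [ConnectedSpace G] (r : LatticeRep G), ∃ m : ℕ, ∀ k : G, ∃ ks : ℕ → G,
      ((List.range m).map ks).prod = k ∧ ∀ i, i < m →
        ∃ X : Matrix (Fin r.N) (Fin r.N) ℂ, (∀ t : ℝ, ∃ kt : G, r.ρ kt = NormedSpace.exp (t • X)) ∧
          frobNorm X ≤ 1 ∧ NormedSpace.exp X = r.ρ (ks i) :=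
  fun _ _ _ _ _ _ r => exists_word r

end Words

end Summit.QuantumFields.YangMills.Theorems.BrascampLiebVacuumSC

end
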